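import Mathlib
import Literature.NumberTheory.Transcendental.KZGaussMultiplicationChain
import HarnessLib
import HarnessLib.Audit

/-!
# SoloInformed — the `√3`-chain: an isogeny move between `β(⅙,½)` and `β(⅓,½)` (Theorem IX‴, I)

A NEW KIND of derived relation in Kontsevich–Zagier's calculus: an IRRATIONAL ALGEBRAIC ratio of
two one-dimensional periods, obtained by ONE change of variables (KZ rule 2) with a rational map.

**Theorem IX‴ (chain).** For representations pinned as `B₃ = β(⅓,½) = [(0,1), t^{⅓−1}(1−t)^{½−1}]`
and `B₆ = β(⅙,½)`:  `[√3 · B₃] − [B₆] ∈ changeOfVariablesRel`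
(`soloInformed_isogeny_mem_changeOfVariablesRel`), hence
`⟦β(⅙,½)⟧ = ⟦[pt, √3]⟧ · ⟦β(⅓,½)⟧` in the formal period ring (`soloInformed_isogeny_chain`)
and `B(⅙,½) = √3 · B(⅓,½)` (`soloInformed_value_betaSixthHalf_eq_sqrt_three_mul`).

The substitution is `t' = ψ(t) = 27t²/(4 − t)³`, a strictly increasing rational bijection of
`(0,1)` with `1 − ψ(t) = (1 − t)(t + 8)²/(4 − t)³` and `ψ'(t) = 27t(t + 8)/(4 − t)⁴`, whence
`ψ^{−5/6}(1 − ψ)^{−1/2} ψ' = 27^{1/6} · t^{−2/3}(1 − t)^{−1/2}` EXACTLY (`27^{1/6} = √3`;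
`soloInformed_isogeny_integrand_identity`).  Geometrically `ψ` is the `3`-isogeny
`(x, y) ↦ ((x³ + 4)/x², y(x³ − 8)/x³)` of the CM curve `y² = x³ + 1` onto `Y² = X³ − 27`
(kernel `{O, (0, ±1)}`), read in the Beta coordinates `t = −x³`, `t' = 27/X³`; no `π`, no
product and no cancellation enter — in contrast with the reflection/Dirichlet derivation, which
only reaches `4⟦π⟧²(⟦β(⅙,½)⟧² − 3⟦β(⅓,½)⟧²) = 0`.  The sector consequences (quadratic descent,
`KZP` on `ℤ[⟦[pt,√3]⟧, ⟦β(⅓,½)⟧, ⟦π⟧]`) are in `SoloInformedIsogenySector.lean`.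
Residency `solo-KontsevichZagierPeriods-informed` (s22); paper §6octies (rung S2).

References: M. Kontsevich, D. Zagier, *Periods* (2001), §1.2 (rules 1–3); J. Vélu, *Isogénies
entre courbes elliptiques*, C. R. Acad. Sci. Paris 273 (1971) (the isogeny formula);
Andrews–Askey–Roy (1999), Thm. 1.1.4 (Beta integral).
-/

noncomputable section

open MeasureTheory Set Filter
namespace Summit.KontsevichZagierPeriods.KontsevichZagierPeriods.Theorems

open Literature.NumberTheory.Transcendental Literature.NumberTheory.Transcendental.KZ
open Literature.ModelTheory.ExponentialFields

/-! ### The substitution `ψ(t) = 27t² / (4 − t)³` (the `3`-isogeny of `y² = x³ + 1` in Beta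
coordinates) -/

/-- The `3`-isogeny of the CM curve `y² = x³ + 1` written in the Beta coordinate `t`:
`ψ(t) = 27 t² / (4 − t)³`. -/
def soloInformedIsogenyFun (t : ℝ) : ℝ := 27 * t ^ 2 / (4 - t) ^ 3

/-- The derivative `ψ'(t) = 27 t (t + 8) / (4 − t)⁴`. -/
def soloInformedIsogenyDeriv (t : ℝ) : ℝ := 27 * t * (t + 8) / (4 - t) ^ 4

/-- The key factorisation `1 − ψ(t) = (1 − t)(t + 8)² / (4 − t)³`
(i.e. `(4 − t)³ − 27t² = (1 − t)(t + 8)²`). -/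
theorem soloInformed_one_sub_isogenyFun {t : ℝ} (ht : t ≠ 4) :
    1 - soloInformedIsogenyFun t = (1 - t) * (t + 8) ^ 2 / (4 - t) ^ 3 := by
  have h4 : (4 - t) ≠ 0 := sub_ne_zero.2 (Ne.symm ht)
  unfold soloInformedIsogenyFun
  field_simp
  ring

/-- `ψ` is differentiable away from `t = 4`, with derivative `ψ'`. -/
theorem soloInformed_hasDerivAt_isogenyFun {t : ℝ} (ht : t ≠ 4) :
    HasDerivAt soloInformedIsogenyFun (soloInformedIsogenyDeriv t) t := by
  have h4 : (4 - t) ≠ 0 := sub_ne_zero.2 (Ne.symm ht)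
  have hl : HasDerivAt (fun y : ℝ => 4 - y) (-1) t := (hasDerivAt_id' t).const_sub 4
  have h := (((hasDerivAt_id' t).mul (hasDerivAt_id' t)).const_mul (27:ℝ)).div
    (hl.mul (hl.mul hl)) (mul_ne_zero h4 (mul_ne_zero h4 h4))
  have hfun : soloInformedIsogenyFun =
      fun y : ℝ => 27 * (y * y) / ((4 - y) * ((4 - y) * (4 - y))) := by
    funext y
    simp only [soloInformedIsogenyFun]
    ring
  rw [hfun]
  refine h.congr_deriv ?_
  simp only [Pi.mul_apply, soloInformedIsogenyDeriv]
  field_simp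
  ring

/-- `ψ > 0` on `(0, 4)`. -/
theorem soloInformed_isogenyFun_pos {t : ℝ} (ht : 0 < t) (ht4 : t < 4) :
    0 < soloInformedIsogenyFun t := by
  unfold soloInformedIsogenyFun
  have : 0 < 4 - t := by linarith
  positivity

/-- `ψ < 1` on `(0, 1)`. -/
theorem soloInformed_isogenyFun_lt_one {t : ℝ} (ht : 0 < t) (ht1 : t < 1) :
    soloInformedIsogenyFun t < 1 := by
  have h := soloInformed_one_sub_isogenyFun (show t ≠ 4 from ne_of_lt (by linarith))
  have h1 : 0 < 1 - t := by linarith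
  have h4 : 0 < 4 - t := by linarith
  have : 0 < (1 - t) * (t + 8) ^ 2 / (4 - t) ^ 3 := by positivity
  linarith

/-- `ψ' > 0` on `(0, 4)`. -/
theorem soloInformed_isogenyDeriv_pos {t : ℝ} (ht : 0 < t) (ht4 : t < 4) :
    0 < soloInformedIsogenyDeriv t := by
  unfold soloInformedIsogenyDeriv
  have : 0 < 4 - t := by linarith
  positivity

/-- `ψ` is continuous on `[0, 1]`. -/
theorem soloInformed_continuousOn_isogenyFun :
    ContinuousOn soloInformedIsogenyFun (Icc (0:ℝ) 1) := fun t ht =>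
  (soloInformed_hasDerivAt_isogenyFun
    (show t ≠ 4 from ne_of_lt (by linarith [ht.2]))).continuousAt.continuousWithinAt

/-- `ψ` is strictly increasing on `[0, 1]`. -/
theorem soloInformed_strictMonoOn_isogenyFun :
    StrictMonoOn soloInformedIsogenyFun (Icc (0:ℝ) 1) := by
  refine strictMonoOn_of_deriv_pos (convex_Icc 0 1) soloInformed_continuousOn_isogenyFun
    fun t ht => ?_
  rw [interior_Icc] at ht
  rw [(soloInformed_hasDerivAt_isogenyFun (show t ≠ 4 from ne_of_lt (by linarith [ht.2]))).deriv]
  exact soloInformed_isogenyDeriv_pos ht.1 (by linarith [ht.2])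

/-- `ψ` maps `(0, 1)` ONTO `(0, 1)` (`ψ(0) = 0`, `ψ(1) = 1`, intermediate values). -/
theorem soloInformed_image_isogenyFun :
    soloInformedIsogenyFun '' Ioo (0:ℝ) 1 = Ioo (0:ℝ) 1 := by
  refine Subset.antisymm ?_ ?_
  · rintro _ ⟨t, ht, rfl⟩
    exact ⟨soloInformed_isogenyFun_pos ht.1 (by linarith [ht.2]),
      soloInformed_isogenyFun_lt_one ht.1 ht.2⟩
  · have h := intermediate_value_Ioo (zero_le_one : (0:ℝ) ≤ 1)
      soloInformed_continuousOn_isogenyFun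
    have h0 : soloInformedIsogenyFun 0 = 0 := by norm_num [soloInformedIsogenyFun]
    have h1 : soloInformedIsogenyFun 1 = 1 := by norm_num [soloInformedIsogenyFun]
    rwa [h0, h1] at h

/-! ### The substitution as a move of KZ's calculus on `ℝ¹` -/

/-- `Φ(x) = (ψ(x₀))` on `ℝ¹`. -/
def soloInformedIsogenyMap (x : Fin 1 → ℝ) : Fin 1 → ℝ := fun _ => soloInformedIsogenyFun (x 0)

/-- `DΦ(x) = ψ'(x₀) · id`. -/
def soloInformedIsogenyMapDeriv (x : Fin 1 → ℝ) : (Fin 1 → ℝ) →L[ℝ] (Fin 1 → ℝ) :=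
  soloInformedIsogenyDeriv (x 0) • ContinuousLinearMap.id ℝ (Fin 1 → ℝ)

/-- `det DΦ(x) = ψ'(x₀)`. -/
theorem soloInformed_det_isogenyMapDeriv (x : Fin 1 → ℝ) :
    (soloInformedIsogenyMapDeriv x).det = soloInformedIsogenyDeriv (x 0) := by
  change LinearMap.det ((soloInformedIsogenyMapDeriv x : (Fin 1 → ℝ) →L[ℝ] (Fin 1 → ℝ)) :
    (Fin 1 → ℝ) →ₗ[ℝ] (Fin 1 → ℝ)) = _
  rw [soloInformedIsogenyMapDeriv, ContinuousLinearMap.toLinearMap_smul,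
    ContinuousLinearMap.coe_id, LinearMap.det_smul, LinearMap.det_id, Module.finrank_fin_fun]
  simp

/-- `Φ` has Fréchet derivative `DΦ(x)` at every `x` with `x₀ ≠ 4`. -/
theorem soloInformed_hasFDerivAt_isogenyMap (x : Fin 1 → ℝ) (hx : x 0 ≠ 4) :
    HasFDerivAt soloInformedIsogenyMap (soloInformedIsogenyMapDeriv x) x := by
  have h0 : HasFDerivAt (fun y : Fin 1 → ℝ => y 0)
      (ContinuousLinearMap.proj 0 : (Fin 1 → ℝ) →L[ℝ] ℝ) x := hasFDerivAt_apply 0 x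
  have h1 : HasFDerivAt (soloInformedIsogenyFun ∘ fun y : Fin 1 → ℝ => y 0)
      (soloInformedIsogenyDeriv (x 0) • (ContinuousLinearMap.proj 0 : (Fin 1 → ℝ) →L[ℝ] ℝ)) x :=
    (soloInformed_hasDerivAt_isogenyFun hx).comp_hasFDerivAt x h0
  refine hasFDerivAt_pi'' fun i => ?_
  have hL : (ContinuousLinearMap.proj i).comp (soloInformedIsogenyMapDeriv x) =
      (soloInformedIsogenyDeriv (x 0) • ContinuousLinearMap.proj 0 : (Fin 1 → ℝ) →L[ℝ] ℝ) := by
    refine ContinuousLinearMap.ext fun v => ?_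
    fin_cases i
    simp [soloInformedIsogenyMapDeriv]
  rw [hL]
  exact h1

/-- `Φ` is injective on the interval `{x | x₀ ∈ (0,1)}`. -/
theorem soloInformed_injOn_isogenyMap :
    InjOn soloInformedIsogenyMap {x : Fin 1 → ℝ | x 0 ∈ Ioo (0:ℝ) 1} := by
  intro x hx y hy h
  have h0 : soloInformedIsogenyFun (x 0) = soloInformedIsogenyFun (y 0) := congr_fun h 0
  have hxy := soloInformed_strictMonoOn_isogenyFun.injOn (Ioo_subset_Icc_self hx)
    (Ioo_subset_Icc_self hy) h0
  funext i
  fin_cases i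
  exact hxy

/-- `Φ` maps the interval `{x | x₀ ∈ (0,1)}` onto itself. -/
theorem soloInformed_image_isogenyMap :
    soloInformedIsogenyMap '' {x : Fin 1 → ℝ | x 0 ∈ Ioo (0:ℝ) 1} =
      {x : Fin 1 → ℝ | x 0 ∈ Ioo (0:ℝ) 1} := by
  ext y
  constructor
  · rintro ⟨x, hx, rfl⟩
    have : soloInformedIsogenyFun (x 0) ∈ Ioo (0:ℝ) 1 := by
      rw [← soloInformed_image_isogenyFun]
      exact mem_image_of_mem _ hx
    exact this
  · intro hy
    obtain ⟨t, ht, hty⟩ : y 0 ∈ soloInformedIsogenyFun '' Ioo 0 1 := by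
      rw [soloInformed_image_isogenyFun]
      exact hy
    refine ⟨fun _ => t, ht, ?_⟩
    funext i
    fin_cases i
    exact hty

/-- `Φ` is `ℚ`-semialgebraic (a quotient of polynomials with rational coefficients whose
denominator does not vanish on the domain). -/
theorem soloInformed_isSemialgebraicMapOn_isogenyMap {D : Set (Fin 1 → ℝ)}
    (hD : IsSemialgebraic ℚ D) (hD4 : D ⊆ {x | x 0 < 4}) :
    IsSemialgebraicMapOn ℚ D soloInformedIsogenyMap := by
  refine IsSemialgebraicMapOn.of_forall hD fun j => ?_
  refine (isSemialgebraicFunOn_aeval_div_aeval hD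
    (MvPolynomial.C 27 * MvPolynomial.X 0 ^ 2) ((MvPolynomial.C 4 - MvPolynomial.X 0) ^ 3)
    fun x hx => ?_).congr fun x hx => ?_
  · have h4 : x 0 < 4 := hD4 hx
    have : (4 : ℝ) - x 0 ≠ 0 := sub_ne_zero.2 (ne_of_gt h4)
    simpa using pow_ne_zero 3 this
  · simp [soloInformedIsogenyMap, soloInformedIsogenyFun]

/-! ### The integrand identity and the move -/

/-- `(x^e)⁶ = 1/x^k` when `6e = −k` (`x > 0`). -/
theorem soloInformed_rpow_pow_six {x : ℝ} (hx : 0 < x) (e : ℝ) (k : ℕ) (h : e * 6 = -(k : ℝ)) :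
    (x ^ e) ^ 6 = (x ^ k)⁻¹ := by
  rw [← Real.rpow_natCast (x ^ e) 6, ← Real.rpow_mul hx.le, Nat.cast_ofNat, h,
    Real.rpow_neg hx.le, Real.rpow_natCast]

/-- `(√3)⁶ = 27`. -/
theorem soloInformed_sqrt_three_pow_six : Real.sqrt 3 ^ 6 = 27 := by
  rw [show (6:ℕ) = 2 * 3 from rfl, pow_mul, Real.sq_sqrt (by norm_num : (0:ℝ) ≤ 3)]
  norm_num

/-- **The integrand identity of the isogeny move**: for `t ∈ (0,1)`,
`ψ(t)^{1/6−1} (1 − ψ(t))^{1/2−1} ψ'(t) = √3 · t^{1/3−1} (1 − t)^{1/2−1}`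
(both sides are positive and their sixth powers agree, by `1 − ψ = (1−t)(t+8)²/(4−t)³` and
`27^{1/6} = √3`). -/
theorem soloInformed_isogeny_integrand_identity {t : ℝ} (ht0 : 0 < t) (ht1 : t < 1) :
    Real.sqrt 3 * ((t ^ (((1 / 3 : ℚ) : ℝ) - 1)) * (1 - t) ^ (((1 / 2 : ℚ) : ℝ) - 1)) =
      soloInformedIsogenyFun t ^ (((1 / 6 : ℚ) : ℝ) - 1) *
        (1 - soloInformedIsogenyFun t) ^ (((1 / 2 : ℚ) : ℝ) - 1) * soloInformedIsogenyDeriv t := by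
  have h4 : t ≠ 4 := ne_of_lt (by linarith)
  have hψ0 : 0 < soloInformedIsogenyFun t := soloInformed_isogenyFun_pos ht0 (by linarith)
  have hψ1 : 0 < 1 - soloInformedIsogenyFun t :=
    sub_pos.2 (soloInformed_isogenyFun_lt_one ht0 ht1)
  have hψ' : 0 < soloInformedIsogenyDeriv t := soloInformed_isogenyDeriv_pos ht0 (by linarith)
  have h1t : 0 < 1 - t := by linarith
  have h3 : 0 < Real.sqrt 3 := Real.sqrt_pos.2 (by norm_num)
  push_cast
  rw [← pow_left_inj₀ (by positivity) (by positivity) (by norm_num : (6:ℕ) ≠ 0)]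
  simp only [mul_pow]
  rw [soloInformed_rpow_pow_six ht0 _ 4 (by norm_num),
    soloInformed_rpow_pow_six h1t _ 3 (by norm_num),
    soloInformed_rpow_pow_six hψ0 _ 5 (by norm_num),
    soloInformed_rpow_pow_six hψ1 _ 3 (by norm_num),
    soloInformed_sqrt_three_pow_six, soloInformed_one_sub_isogenyFun h4]
  unfold soloInformedIsogenyFun soloInformedIsogenyDeriv
  have h4' : (4:ℝ) - t ≠ 0 := sub_ne_zero.2 h4.symm
  have h8 : t + 8 ≠ 0 := ne_of_gt (by linarith)
  have ht0' : t ≠ 0 := ht0.ne'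
  have h1t' : 1 - t ≠ 0 := h1t.ne'
  field_simp

/-- `√n` is algebraic over `ℚ` for every natural number `n` (root of `X² − n`); used at `n = 3`
(the numeral `(3 : ℝ)` and the cast `((3 : ℕ) : ℝ)` agree definitionally). -/
theorem soloInformed_isAlgebraic_sqrt_natCast (n : ℕ) : IsAlgebraic ℚ (Real.sqrt (n : ℝ)) := by
  refine ⟨Polynomial.X ^ 2 - Polynomial.C (n : ℚ),
    (Polynomial.monic_X_pow_sub_C (n : ℚ) two_ne_zero).ne_zero, ?_⟩
  simp [Real.sq_sqrt (Nat.cast_nonneg n)]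

/-- **The isogeny move (ONE change of variables, KZ rule 2).** For representations pinned as
`B₃ = β(⅓,½) = [(0,1), t^{1/3−1}(1−t)^{1/2−1}]` and `B₆ = β(⅙,½)`, the substitution
`t' = ψ(t) = 27t²/(4 − t)³` — a `ℚ`-rational, strictly increasing bijection of `(0,1)` — carries
`β(⅙,½)` to `√3 · β(⅓,½)`:  `[√3 · B₃] − [B₆] ∈ changeOfVariablesRel`. No `π`, no product, no
cancellation is involved. (`ψ` is the `3`-isogeny `y² = x³ + 1 → Y² = X³ − 27` with kernel
`{O, (0, ±1)}`, `X = (x³ + 4)/x²`, composed with the Beta parametrisations.) -/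
theorem soloInformed_isogeny_mem_changeOfVariablesRel (B₃ B₆ : IntegralRep 1)
    (hB₃d : B₃.domain = {t | t 0 ∈ Set.Ioo (0:ℝ) 1})
    (hB₃i : Set.EqOn B₃.integrand
      (fun t => (t 0) ^ (((1 / 3 : ℚ) : ℝ) - 1) * (1 - t 0) ^ (((1 / 2 : ℚ) : ℝ) - 1)) B₃.domain)
    (hB₆d : B₆.domain = {t | t 0 ∈ Set.Ioo (0:ℝ) 1})
    (hB₆i : Set.EqOn B₆.integrand
      (fun t => (t 0) ^ (((1 / 6 : ℚ) : ℝ) - 1) * (1 - t 0) ^ (((1 / 2 : ℚ) : ℝ) - 1)) B₆.domain) :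
    of (B₃.constMul (Real.sqrt 3) (soloInformed_isAlgebraic_sqrt_natCast 3)) - of B₆ ∈
      changeOfVariablesRel := by
  have hD4 : {t : Fin 1 → ℝ | t 0 ∈ Set.Ioo (0:ℝ) 1} ⊆ {x | x 0 < 4} := fun x hx => by
    simp only [mem_setOf_eq] at hx ⊢
    linarith [hx.2]
  refine ⟨1, B₃.constMul (Real.sqrt 3) (soloInformed_isAlgebraic_sqrt_natCast 3), B₆,
    soloInformedIsogenyMap, soloInformedIsogenyMapDeriv, ?_, fun x hx => ?_, ?_, ?_,
    fun x hx => ?_, rfl⟩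
  · rw [IntegralRep.domain_constMul, hB₃d]
    exact soloInformed_isSemialgebraicMapOn_isogenyMap (hB₃d ▸ B₃.isSemialgebraic_domain) hD4
  · rw [IntegralRep.domain_constMul, hB₃d] at hx ⊢
    have hx4 : x 0 ≠ 4 := ne_of_lt (hD4 hx)
    exact (soloInformed_hasFDerivAt_isogenyMap x hx4).hasFDerivWithinAt
  · rw [IntegralRep.domain_constMul, hB₃d]
    exact soloInformed_injOn_isogenyMap
  · rw [IntegralRep.domain_constMul, hB₃d, hB₆d, soloInformed_image_isogenyMap]
  · have hx' : x 0 ∈ Set.Ioo (0:ℝ) 1 := by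
      rw [IntegralRep.domain_constMul, hB₃d] at hx
      exact hx
    have hΦ : soloInformedIsogenyMap x ∈ B₆.domain := by
      rw [hB₆d, ← soloInformed_image_isogenyMap]
      exact mem_image_of_mem _ (show x ∈ {t : Fin 1 → ℝ | t 0 ∈ Set.Ioo (0:ℝ) 1} from hx')
    have hx3 : x ∈ B₃.domain := by rw [hB₃d]; exact hx'
    rw [IntegralRep.integrand_constMul]
    dsimp only
    rw [hB₃i hx3, hB₆i hΦ, soloInformed_det_isogenyMapDeriv,
      abs_of_pos (soloInformed_isogenyDeriv_pos hx'.1 (by linarith [hx'.2]))]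
    exact soloInformed_isogeny_integrand_identity hx'.1 hx'.2

/-- **`√3 · β(⅓,½) ∼ β(⅙,½)`** (pinned representations). -/
theorem soloInformed_isogeny_equivalent (B₃ B₆ : IntegralRep 1)
    (hB₃d : B₃.domain = {t | t 0 ∈ Set.Ioo (0:ℝ) 1})
    (hB₃i : Set.EqOn B₃.integrand
      (fun t => (t 0) ^ (((1 / 3 : ℚ) : ℝ) - 1) * (1 - t 0) ^ (((1 / 2 : ℚ) : ℝ) - 1)) B₃.domain)
    (hB₆d : B₆.domain = {t | t 0 ∈ Set.Ioo (0:ℝ) 1})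
    (hB₆i : Set.EqOn B₆.integrand
      (fun t => (t 0) ^ (((1 / 6 : ℚ) : ℝ) - 1) * (1 - t 0) ^ (((1 / 2 : ℚ) : ℝ) - 1)) B₆.domain) :
    Equivalent (B₃.constMul (Real.sqrt 3) (soloInformed_isAlgebraic_sqrt_natCast 3)) B₆ :=
  changeOfVariablesRel_subset_relations
    (soloInformed_isogeny_mem_changeOfVariablesRel B₃ B₆ hB₃d hB₃i hB₆d hB₆i)

/-- **THEOREM IX‴ (the `√3`-chain).** `⟦β(⅙,½)⟧ = ⟦[pt, √3]⟧ · ⟦β(⅓,½)⟧` in the formal period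
ring: an IRRATIONAL algebraic ratio of two one-dimensional periods, derived by the moves
(isogeny substitution + relabelling `⟦√3 · r⟧ = ⟦[pt,√3]⟧⟦r⟧`). -/
theorem soloInformed_isogeny_chain (B₃ B₆ : IntegralRep 1)
    (hB₃d : B₃.domain = {t | t 0 ∈ Set.Ioo (0:ℝ) 1})
    (hB₃i : Set.EqOn B₃.integrand
      (fun t => (t 0) ^ (((1 / 3 : ℚ) : ℝ) - 1) * (1 - t 0) ^ (((1 / 2 : ℚ) : ℝ) - 1)) B₃.domain)
    (hB₆d : B₆.domain = {t | t 0 ∈ Set.Ioo (0:ℝ) 1})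
    (hB₆i : Set.EqOn B₆.integrand
      (fun t => (t 0) ^ (((1 / 6 : ℚ) : ℝ) - 1) * (1 - t 0) ^ (((1 / 2 : ℚ) : ℝ) - 1)) B₆.domain) :
    toFormalPeriod (of B₆) =
      toFormalPeriod (of (IntegralRep.unit.constMul (Real.sqrt 3)
        (soloInformed_isAlgebraic_sqrt_natCast 3))) * toFormalPeriod (of B₃) := by
  rw [← toFormalPeriod_of_constMul]
  exact ((soloInformed_isogeny_equivalent B₃ B₆ hB₃d hB₃i hB₆d hB₆i).toFormalPeriod_eq).symm

/-- **Value form**: `B(⅙,½) = √3 · B(⅓,½)` (classically: reflection `Γ(s)Γ(1−s) = π/sin πs` at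
`s = ⅙, ⅓`; here a consequence of ONE change of variables). -/
theorem soloInformed_value_betaSixthHalf_eq_sqrt_three_mul (B₃ B₆ : IntegralRep 1)
    (hB₃d : B₃.domain = {t | t 0 ∈ Set.Ioo (0:ℝ) 1})
    (hB₃i : Set.EqOn B₃.integrand
      (fun t => (t 0) ^ (((1 / 3 : ℚ) : ℝ) - 1) * (1 - t 0) ^ (((1 / 2 : ℚ) : ℝ) - 1)) B₃.domain)
    (hB₆d : B₆.domain = {t | t 0 ∈ Set.Ioo (0:ℝ) 1})
    (hB₆i : Set.EqOn B₆.integrand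
      (fun t => (t 0) ^ (((1 / 6 : ℚ) : ℝ) - 1) * (1 - t 0) ^ (((1 / 2 : ℚ) : ℝ) - 1)) B₆.domain) :
    B₆.value = Real.sqrt 3 * B₃.value := by
  have h := Equivalent.value_eq_holds
    (soloInformed_isogeny_equivalent B₃ B₆ hB₃d hB₃i hB₆d hB₆i)
  rw [IntegralRep.value_constMul] at h
  exact h.symm

end Summit.KontsevichZagierPeriods.KontsevichZagierPeriods.Theorems

end
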